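import Mathlib
import Summits.NavierStokesRegularity.NavierStokesRegularity.Theorems.FilamentSkeletonRssKelvinGateTightnessSpikeData

/-!
# Route `FilamentSkeletonRss` · crux `TransverseReductionRJ` (stmt-NavierStokesRegularity-21221) — line `kelvin_gate`, stub S3
# `NonlinearClosingFrom`: the gate's tightness clause (3) AS TYPED (per parameter) does NOT control the multipliers at moving data
# (part 3 of 3: the witness)

Helper file (theorems only, `--supports stmt-NavierStokesRegularity-21221`), vocabulary of `FilamentSkeletonRssKelvinGateDefs`
(`YBound`).  HONEST FRAMING: bookkeeping for a HYPOTHETICAL filament-type RSS blow-up route (MODEL rung, negative side, ASIDE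
item); nothing here bears on Navier–Stokes regularity; the registered stub `stub_nonlinearClosing : NonlinearClosingFrom` is
neither proved nor refuted here.

WHAT IS PROVED, AND WHY IT MATTERS FOR THE TYPING.  `Theorems.KelvinGate.nonlinearClosing_static` (landed) reduces S3 to ONE
conjunct of `AlmostAdmissibleJ`: continuity on the cube of `p ↦ b⁰_p + 𝓑_p G_p` at the Picard fixed-point forcing `G_p`; and
`Theorems.KelvinGate.GateSpec.continuousOn_multiplier_of_uniformTight` (p826991) proves that conjunct once clause (3) of `GateSpec`
(tightness: `∀ R L ε, ∃ L' δ₀, …`) is quantified UNIFORMLY in `p`.  This file shows that the uniformity cannot be dropped at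
the level of the clauses the gate imposes on the multiplier functional `𝓑`: `perParameter_tightness_insufficient` exhibits,
on the one-dimensional cube `[0,1]`, an explicit family `𝓑_p` satisfying the `𝓑`-parts of `GateSpec` (1) (uniform bound
`|𝓑_p F| ≤ C·R` for `YBound F R`), (2) (linearity), (3) (tightness, PER `p`, exactly as typed) and (4) (continuity in `p` at
fixed data), together with an explicit data family `G_p` that is uniformly `Y`-bounded and converges uniformly on the whole
space as `q → p` (more than `BaseSpec`'s local `C⁰` continuity of residuals gives), such that `p ↦ 𝓑_p G_p` is NOT continuous
on the cube.  The mechanism («spike functional», parts 1–2): `𝓑_p F = ∫ φ(t) sin(2πt/p₀) ∂_t⟪F(t e₀), e₀⟫ dt` — bounded by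
`‖φ‖₁·R`, tight at each fixed `p` by one integration by parts (constant `~1/p₀`, degenerating as `p₀ → 0`), continuous in `p`
at fixed `C¹` data by the Riemann–Lebesgue lemma at `p₀ = 0` and a frequency-Lipschitz bound elsewhere — against the data
`G_p(y) = (p₀/2π) cos(2π⟪e₀,y⟫/p₀) Φ(y) e₀` (`→ 0` uniformly, `C¹`-bounded), for which `𝓑_p G_p = −∫ φ sin²(2πt/p₀) ≤ −1/2`
while `𝓑_0 G_0 = 0`.  Consequence for the line: the «moving functional on moving data» term of the Picard continuity step is
genuinely uncontrolled by clause (3) as typed; whether the CONCRETE linearised profile operator admits such a gate depends on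
the existence of a nonzero X-bounded solution of `𝓛V + ∇q ∈ span{D_pj}` with nonzero multiplier (not addressed here), so S3
as typed is not refuted — but its by-name closure through the registered route requires the p-uniform retype of clause (3)
(`RETYPE-S3-21221-leafhand12-g0.md`, evidence on the item), which this file shows is necessary and not merely convenient.
-/

set_option linter.dupNamespace false

noncomputable section

namespace Summit.NavierStokesRegularity.NavierStokesRegularity.Theorems.KelvinGate

open Set Function Filter MeasureTheory Topology Real
open scoped InnerProductSpace FourierTransform

/-! ## §3  The witness: per-parameter tightness does not control the multipliers at moving data -/

/-- **Per-parameter tightness is insufficient.**  On the one-dimensional cube `[0,1]` there are a multiplier family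
`𝓑 : (Fin 1 → ℝ) → (ℝ³ → ℝ³) → Fin 1 → ℝ` and a data family `G : (Fin 1 → ℝ) → ℝ³ → ℝ³` such that `𝓑` satisfies the
`𝓑`-parts of the four clauses of `GateSpec` AS TYPED — (1) the uniform bound `|𝓑_p F j| ≤ C·R` for `YBound F R`, (2) linearity,
(3) tightness with radii `L', δ₀` chosen PER `p`, (4) continuity in `p` at fixed data —, `G_p` is uniformly `Y`-bounded and
`q ↦ G_q` is continuous in sup norm on the whole space, and nevertheless `p ↦ 𝓑_p (G_p) 0` is NOT continuous on the cube.
Witness: `𝓑_p F = ∫ φ(t) sin(2πt/p₀) ∂_t⟪F(te₀),e₀⟫ dt`, `G_p(y) = (p₀/2π) cos(2π⟪e₀,y⟫/p₀) Φ(y) e₀` with bumps `φ` (`= 1` on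
`[−1,1]`, support `(−2,2)`) and `Φ` (`= 1` on `‖y‖ ≤ 2`, support `‖y‖ < 3`), `e₀` the first basis vector: `𝓑_p G_p = −∫φ sin² ≤ −1/2`
for `0 < p₀ ≤ 1` while `𝓑_0 G_0 = 0`.  Hence the p-UNIFORM form of clause (3) used in
`GateSpec.continuousOn_multiplier_of_uniformTight` cannot be weakened to the registered per-`p` form at the level of these
clauses. [folklore] -/
theorem perParameter_tightness_insufficient :
    ∃ (𝓑 : (Fin 1 → ℝ) → (EuclideanSpace ℝ (Fin 3) → EuclideanSpace ℝ (Fin 3)) → Fin 1 → ℝ)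
      (G : (Fin 1 → ℝ) → EuclideanSpace ℝ (Fin 3) → EuclideanSpace ℝ (Fin 3)) (C R : ℝ),
      (∀ p : Fin 1 → ℝ, (∀ i, p i ∈ Icc (0:ℝ) 1) →
        ∀ (F : EuclideanSpace ℝ (Fin 3) → EuclideanSpace ℝ (Fin 3)) (R' : ℝ), YBound F R' → ∀ j, |𝓑 p F j| ≤ C * R') ∧
      (∀ p : Fin 1 → ℝ, (∀ i, p i ∈ Icc (0:ℝ) 1) →
        ∀ (F F' : EuclideanSpace ℝ (Fin 3) → EuclideanSpace ℝ (Fin 3)) (s : ℝ), (∃ R', YBound F R') → (∃ R', YBound F' R') →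
          𝓑 p (fun y => F y + s • F' y) = fun j => 𝓑 p F j + s * 𝓑 p F' j) ∧
      (∀ p : Fin 1 → ℝ, (∀ i, p i ∈ Icc (0:ℝ) 1) → ∀ R' ε : ℝ, 0 < ε → ∃ L' δ₀ : ℝ, 0 < δ₀ ∧
        ∀ F : EuclideanSpace ℝ (Fin 3) → EuclideanSpace ℝ (Fin 3), YBound F R' →
          (∀ y, ‖y‖ ≤ L' → ‖F y‖ ≤ δ₀) → ∀ j, |𝓑 p F j| ≤ ε) ∧
      (∀ p : Fin 1 → ℝ, (∀ i, p i ∈ Icc (0:ℝ) 1) →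
        ∀ (F : EuclideanSpace ℝ (Fin 3) → EuclideanSpace ℝ (Fin 3)) (R' ε : ℝ), YBound F R' → 0 < ε →
          ∃ δ' : ℝ, 0 < δ' ∧ ∀ q : Fin 1 → ℝ, (∀ i, q i ∈ Icc (0:ℝ) 1) → dist q p < δ' →
            ∀ j, |𝓑 q F j - 𝓑 p F j| ≤ ε) ∧
      (∀ p : Fin 1 → ℝ, (∀ i, p i ∈ Icc (0:ℝ) 1) → YBound (G p) R) ∧
      (∀ p : Fin 1 → ℝ, (∀ i, p i ∈ Icc (0:ℝ) 1) → ∀ ε : ℝ, 0 < ε → ∃ δ' : ℝ, 0 < δ' ∧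
        ∀ q : Fin 1 → ℝ, (∀ i, q i ∈ Icc (0:ℝ) 1) → dist q p < δ' → ∀ y, ‖G q y - G p y‖ ≤ ε) ∧
      ¬ ContinuousOn (fun p => 𝓑 p (G p) 0) {p : Fin 1 → ℝ | ∀ i, p i ∈ Icc (0:ℝ) 1} := by
  -- the two bumps, the direction, the derivative bound of the space bump
  let φ : ContDiffBump (0:ℝ) := ⟨1, 2, one_pos, one_lt_two⟩
  let Φ : ContDiffBump (0 : EuclideanSpace ℝ (Fin 3)) := ⟨2, 3, two_pos, by norm_num⟩
  let e : EuclideanSpace ℝ (Fin 3) := EuclideanSpace.single 0 1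
  have he : ‖e‖ = 1 := by simp [e]
  have hπ : 0 < π := Real.pi_pos
  have hφr : φ.rOut = 2 := rfl
  have hΦr : Φ.rOut = 3 := rfl
  obtain ⟨M₀, hM₀⟩ := (Φ.hasCompactSupport.fderiv ℝ).exists_bound_of_continuous (Φ.contDiff.continuous_fderiv one_ne_zero)
  set M : ℝ := max M₀ 0 with hMdef
  have hM : ∀ y, ‖fderiv ℝ (Φ : EuclideanSpace ℝ (Fin 3) → ℝ) y‖ ≤ M := fun y => le_trans (hM₀ y) (le_max_left _ _)
  have hM0 : 0 ≤ M := le_max_right _ _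
  set C : ℝ := ∫ t, φ t with hC
  have hCpos : 0 < C := φ.integral_pos
  set R : ℝ := (1 + Φ.rOut) ^ 2 * (M + 1) with hR
  -- the witnesses
  refine ⟨fun p F _ => ∫ t, φ t * Real.sin ((2 * π * (p 0)⁻¹) * t) * ⟪fderiv ℝ F (t • e) e, e⟫_ℝ,
    fun p y => ((p 0) / (2 * π) * Real.cos ((2 * π * (p 0)⁻¹) * ⟪e, y⟫_ℝ) * Φ y) • e, C, R,
    ?_, ?_, ?_, ?_, ?_, ?_, ?_⟩
  · -- (1) uniform bound
    intro p _ F R' hF j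
    rw [mul_comm C]
    exact spike_bound φ _ hF he
  · -- (2) linearity
    intro p _ F F' s hF hF'
    obtain ⟨R₁, hF⟩ := hF
    obtain ⟨R₂, hF'⟩ := hF'
    funext j
    have hd : ∀ t : ℝ, fderiv ℝ (fun y => F y + s • F' y) (t • e) = fderiv ℝ F (t • e) + s • fderiv ℝ F' (t • e) := by
      intro t
      have h1 : DifferentiableAt ℝ F (t • e) := (hF.1.differentiable one_ne_zero) _
      have h2 : DifferentiableAt ℝ F' (t • e) := (hF'.1.differentiable one_ne_zero) _
      exact (h1.hasFDerivAt.add (h2.hasFDerivAt.const_smul s)).fderiv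
    have hpt : ∀ t : ℝ, φ t * Real.sin ((2 * π * (p 0)⁻¹) * t) * ⟪fderiv ℝ (fun y => F y + s • F' y) (t • e) e, e⟫_ℝ =
        φ t * Real.sin ((2 * π * (p 0)⁻¹) * t) * ⟪fderiv ℝ F (t • e) e, e⟫_ℝ +
          s * (φ t * Real.sin ((2 * π * (p 0)⁻¹) * t) * ⟪fderiv ℝ F' (t • e) e, e⟫_ℝ) := by
      intro t
      have happ : (fderiv ℝ F (t • e) + s • fderiv ℝ F' (t • e)) e = fderiv ℝ F (t • e) e + s • fderiv ℝ F' (t • e) e := rfl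
      rw [hd t, happ, inner_add_left, real_inner_smul_left]
      ring
    simp_rw [hpt]
    rw [integral_add (spike_integrable φ _ hF.1 e) ((spike_integrable φ _ hF'.1 e).const_mul s), integral_const_mul]
  · -- (3) tightness, PER p
    intro p _ R' ε hε
    set K : ℝ := ∫ t, |deriv φ t * Real.sin ((2 * π * (p 0)⁻¹) * t) + φ t * (Real.cos ((2 * π * (p 0)⁻¹) * t) *
      ((2 * π * (p 0)⁻¹) * 1))| with hK
    have hK0 : 0 ≤ K := integral_nonneg fun t => abs_nonneg _
    refine ⟨φ.rOut, ε / (K + 1), div_pos hε (by linarith), fun F hF hsmall j => ?_⟩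
    refine le_trans (spike_tight φ _ hF.1 he hsmall) ?_
    rw [div_mul_eq_mul_div, div_le_iff₀ (by linarith)]
    nlinarith
  · -- (4) continuity in p at fixed data
    intro p hp F R' ε hF hε
    dsimp only
    have hp0 : 0 ≤ p 0 ∧ p 0 ≤ 1 := ⟨(hp 0).1, (hp 0).2⟩
    by_cases hz : p 0 = 0
    · -- at p₀ = 0: Riemann–Lebesgue
      have hcv' : Continuous (fun t : ℝ => ⟪fderiv ℝ F (t • e) e, e⟫_ℝ) := by
        have h1 : Continuous (fun t : ℝ => fderiv ℝ F (t • e)) :=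
          (hF.1.continuous_fderiv one_ne_zero).comp (continuous_id.smul continuous_const)
        exact (h1.clm_apply continuous_const).inner continuous_const
      obtain ⟨N, hN, hNw⟩ := sin_transform_small_of_continuous_compactSupport (φ.continuous.mul hcv')
        (φ.hasCompactSupport.mul_right) hε
      refine ⟨N⁻¹, inv_pos.mpr hN, fun q hq hdist j => ?_⟩
      have hq0 : 0 ≤ q 0 := (hq 0).1
      have hp00 : ∫ t, φ t * Real.sin ((2 * π * (p 0)⁻¹) * t) * ⟪fderiv ℝ F (t • e) e, e⟫_ℝ = 0 := by
        simp [hz]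
      rw [hp00, sub_zero]
      by_cases hqz : q 0 = 0
      · simp [hqz]; exact hε.le
      · have hqpos : 0 < q 0 := lt_of_le_of_ne hq0 (Ne.symm hqz)
        have hqd : q 0 < N⁻¹ := by
          have := dist_le_pi_dist q p 0
          rw [Real.dist_eq, hz, sub_zero, abs_of_pos hqpos] at this
          linarith
        have hw : N ≤ (q 0)⁻¹ := by
          have := inv_anti₀ hqpos hqd.le
          rwa [inv_inv] at this
        have := hNw _ hw
        have hfun : (fun t => φ t * Real.sin ((2 * π * (q 0)⁻¹) * t) * ⟪fderiv ℝ F (t • e) e, e⟫_ℝ) =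
            fun t => φ t * ⟪fderiv ℝ F (t • e) e, e⟫_ℝ * Real.sin (2 * π * (q 0)⁻¹ * t) := by
          funext t; ring
        rw [hfun]; exact this
    · -- at p₀ > 0: frequency-Lipschitz
      have hppos : 0 < p 0 := lt_of_le_of_ne hp0.1 (Ne.symm hz)
      have hR' : 0 ≤ R' := hF.nonneg
      set D : ℝ := 4 * π * φ.rOut * R' * C + 1 with hD
      have hDpos : 0 < D := by have := φ.rOut_pos; positivity
      refine ⟨min (p 0 / 2) (ε * (p 0) ^ 2 / D), lt_min (by linarith) (div_pos (mul_pos hε (pow_pos hppos 2)) hDpos),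
        fun q hq hdist j => ?_⟩
      have hqp : |q 0 - p 0| < min (p 0 / 2) (ε * (p 0) ^ 2 / D) :=
        lt_of_le_of_lt (by simpa [Real.dist_eq] using dist_le_pi_dist q p 0) hdist
      have hqp1 : |q 0 - p 0| < p 0 / 2 := lt_of_lt_of_le hqp (min_le_left _ _)
      have hqp2 : |q 0 - p 0| < ε * (p 0) ^ 2 / D := lt_of_lt_of_le hqp (min_le_right _ _)
      have hqlow : p 0 / 2 < q 0 := by have := (abs_lt.mp hqp1).1; linarith
      have hqpos : 0 < q 0 := by linarith
      refine le_trans (spike_freq_lipschitz φ _ _ hF he) ?_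
      rw [abs_freq_sub hppos hqpos]
      have hstep : 2 * π * |q 0 - p 0| / (q 0 * p 0) ≤ 4 * π * |q 0 - p 0| / (p 0) ^ 2 := by
        rw [div_le_div_iff₀ (by positivity) (by positivity)]
        have : 0 ≤ 2 * π * |q 0 - p 0| := by positivity
        nlinarith [mul_nonneg (mul_nonneg this hppos.le) (sub_nonneg.mpr hqlow.le)]
      calc 2 * π * |q 0 - p 0| / (q 0 * p 0) * φ.rOut * R' * ∫ t, φ t
          ≤ 4 * π * |q 0 - p 0| / (p 0) ^ 2 * φ.rOut * R' * C := by gcongr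
        _ = (4 * π * φ.rOut * R' * C) * |q 0 - p 0| / (p 0) ^ 2 := by ring
        _ ≤ D * |q 0 - p 0| / (p 0) ^ 2 := by gcongr; linarith
        _ ≤ D * (ε * (p 0) ^ 2 / D) / (p 0) ^ 2 := by gcongr
        _ = ε := by field_simp
  · -- the data family is uniformly Y-bounded
    intro p hp
    have hp0 : 0 ≤ p 0 ∧ p 0 ≤ 1 := ⟨(hp 0).1, (hp 0).2⟩
    have ha : |p 0 / (2 * π)| ≤ 1 := by
      rw [abs_of_nonneg (div_nonneg hp0.1 (by positivity)), div_le_iff₀ (by positivity)]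
      nlinarith [Real.pi_gt_three]
    have hak : |p 0 / (2 * π)| * |2 * π * (p 0)⁻¹| ≤ 1 := by
      rw [← abs_mul]
      by_cases hz : p 0 = 0
      · simp [hz]
      · rw [show p 0 / (2 * π) * (2 * π * (p 0)⁻¹) = 1 by field_simp]; simp
    exact dataField_yBound Φ he hM hM0 ha hak
  · -- the data family moves continuously (uniformly in space)
    intro p hp ε hε
    dsimp only
    have hp0 : 0 ≤ p 0 ∧ p 0 ≤ 1 := ⟨(hp 0).1, (hp 0).2⟩
    by_cases hz : p 0 = 0
    · refine ⟨ε, hε, fun q hq hdist y => ?_⟩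
      have hq0 : 0 ≤ q 0 := (hq 0).1
      refine le_trans (dataField_close Φ he _ _ _ _ y) ?_
      rw [hz]
      simp only [zero_div, abs_zero, zero_mul, add_zero, sub_zero]
      rw [abs_of_nonneg (by positivity), div_le_iff₀ (by positivity)]
      have hqd : q 0 < ε := by
        have := dist_le_pi_dist q p 0
        rw [Real.dist_eq, hz, sub_zero, abs_of_nonneg hq0] at this
        linarith
      nlinarith [Real.pi_gt_three]
    · have hppos : 0 < p 0 := lt_of_le_of_ne hp0.1 (Ne.symm hz)
      set D : ℝ := 1 + 2 * Φ.rOut / p 0 with hD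
      have hDpos : 0 < D := by have := Φ.rOut_pos; positivity
      refine ⟨min (p 0 / 2) (ε / D), lt_min (by linarith) (by positivity), fun q hq hdist y => ?_⟩
      have hqp : |q 0 - p 0| < min (p 0 / 2) (ε / D) :=
        lt_of_le_of_lt (by simpa [Real.dist_eq] using dist_le_pi_dist q p 0) hdist
      have hqp1 : |q 0 - p 0| < p 0 / 2 := lt_of_lt_of_le hqp (min_le_left _ _)
      have hqp2 : |q 0 - p 0| < ε / D := lt_of_lt_of_le hqp (min_le_right _ _)
      have hqlow : p 0 / 2 < q 0 := by have := (abs_lt.mp hqp1).1; linarith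
      have hqpos : 0 < q 0 := by linarith
      refine le_trans (dataField_close Φ he _ _ _ _ y) ?_
      have h1 : |q 0 / (2 * π) - p 0 / (2 * π)| ≤ |q 0 - p 0| := by
        rw [← sub_div, abs_div, abs_of_pos (by positivity : (0:ℝ) < 2 * π)]
        exact div_le_self (abs_nonneg _) (by nlinarith [Real.pi_gt_three])
      have h2 : |p 0 / (2 * π)| * (|2 * π * (q 0)⁻¹ - 2 * π * (p 0)⁻¹| * Φ.rOut) ≤ |q 0 - p 0| * (2 * Φ.rOut / p 0) := by
        rw [abs_freq_sub hppos hqpos, abs_of_pos (by positivity : 0 < p 0 / (2 * π))]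
        have hrq : Φ.rOut / q 0 ≤ 2 * Φ.rOut / p 0 := by
          rw [div_le_div_iff₀ hqpos hppos]
          nlinarith [Φ.rOut_pos]
        have heq : p 0 / (2 * π) * (2 * π * |q 0 - p 0| / (q 0 * p 0) * Φ.rOut) = |q 0 - p 0| * (Φ.rOut / q 0) := by
          field_simp
        rw [heq]
        exact mul_le_mul_of_nonneg_left hrq (abs_nonneg _)
      calc |q 0 / (2 * π) - p 0 / (2 * π)| + |p 0 / (2 * π)| * (|2 * π * (q 0)⁻¹ - 2 * π * (p 0)⁻¹| * Φ.rOut)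
          ≤ |q 0 - p 0| + |q 0 - p 0| * (2 * Φ.rOut / p 0) := add_le_add h1 h2
        _ = |q 0 - p 0| * D := by rw [hD]; ring
        _ ≤ (ε / D) * D := mul_le_mul_of_nonneg_right hqp2.le hDpos.le
        _ = ε := by field_simp
  · -- discontinuity at p = 0
    intro hcont
    have h0mem : (fun _ : Fin 1 => (0:ℝ)) ∈ {p : Fin 1 → ℝ | ∀ i, p i ∈ Icc (0:ℝ) 1} := fun _ => ⟨le_rfl, zero_le_one⟩
    have hcw := hcont _ h0mem
    rw [Metric.continuousWithinAt_iff] at hcw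
    obtain ⟨δ, hδ, hclose⟩ := hcw (1 / 2) (by norm_num)
    set q₀ : ℝ := min (δ / 2) 1 with hq₀
    have hq₀pos : 0 < q₀ := lt_min (by linarith) one_pos
    have hq₀le : q₀ ≤ 1 := min_le_right _ _
    have hqmem : (fun _ : Fin 1 => q₀) ∈ {p : Fin 1 → ℝ | ∀ i, p i ∈ Icc (0:ℝ) 1} := fun _ => ⟨hq₀pos.le, hq₀le⟩
    have hqdist : dist (fun _ : Fin 1 => q₀) (fun _ : Fin 1 => (0:ℝ)) < δ := by
      refine lt_of_le_of_lt ((dist_pi_le_iff hq₀pos.le).mpr fun _ => ?_) (lt_of_le_of_lt (min_le_left _ _) (by linarith))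
      rw [Real.dist_eq, sub_zero, abs_of_pos hq₀pos]
    have hbad := hclose hqmem hqdist
    -- the value at 0 is 0, the value at q₀ is ≤ -1/2
    have hval0 : (∫ t, φ t * Real.sin ((2 * π * ((fun _ : Fin 1 => (0:ℝ)) 0)⁻¹) * t) *
        ⟪fderiv ℝ (fun y => (((fun _ : Fin 1 => (0:ℝ)) 0) / (2 * π) *
          Real.cos ((2 * π * ((fun _ : Fin 1 => (0:ℝ)) 0)⁻¹) * ⟪e, y⟫_ℝ) * Φ y) • e) (t • e) e, e⟫_ℝ) = 0 := by
      simp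
    have hak : q₀ / (2 * π) * (2 * π * q₀⁻¹) = 1 := by field_simp
    have hvalq : (∫ t, φ t * Real.sin ((2 * π * q₀⁻¹) * t) *
        ⟪fderiv ℝ (fun y => (q₀ / (2 * π) * Real.cos ((2 * π * q₀⁻¹) * ⟪e, y⟫_ℝ) * Φ y) • e) (t • e) e, e⟫_ℝ) ≤ -(1 / 2) := by
      rw [spike_on_data φ Φ (le_refl _) he hak, neg_le_neg_iff]
      refine half_le_integral_bump_sin_sq φ (le_refl _) ?_
      rw [show 2 * π * q₀⁻¹ = 2 * π / q₀ by rw [div_eq_mul_inv], le_div_iff₀ hq₀pos]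
      nlinarith
    rw [Real.dist_eq] at hbad
    simp only at hbad
    rw [hval0, sub_zero] at hbad
    have := (abs_lt.mp hbad).1
    linarith

end Summit.NavierStokesRegularity.NavierStokesRegularity.Theorems.KelvinGate
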